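/-
Copyright (c) 2026. All rights reserved.
Released under Apache 2.0 license as described in the file LICENSE.
Authors: abc-iut cell, prover seat abc-iut-L4-t5 (gen 9), over the statements of abc-iut-L4-t3 (`LogFrobeniusGraphs.lean`,
`LogFrobeniusObservables.lean`); `TS`-side analogue of the graph combinatorics of abc-iut-f-101's `LogFrobeniusObservablesMoves.lean`.
-/
import Literature.AnabelianGeometry.AbsoluteAnabelian.LogFrobeniusObservablesMoves
import Literature.AnabelianGeometry.AbsoluteAnabelian.LogFrobeniusObservables
import HarnessLib

/-!
# [AbsTopIII] Definition 5.4 (iii), (v), (vii): combinatorics of the FULL graph `Γ⃗^log_v` (index set of the `TS`-valued `ι_{v,ε}`) — rank, sinks, forks, diamonds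

S. Mochizuki, *Topics in absolute anabelian geometry III: global reconstruction algorithms*,
J. Math. Sci. Univ. Tokyo 22 (2015) 939–1156 [MochizukiAbsTopIII2015]; locators `p.N` = pages of the author's
manuscript (`paper:url-5493eb38cbb7`): Def 5.4 (iii) p. 126 (the nonarchimedean graph `Γ⃗^log_non` with all six arrows,
including the upper right-hand arrow `k̄^× ↪ k̄` into the space-link vertex, which is NOT in `Γ⃗^⋉_non`; "a commutative
diagram"), (v) p. 127 (`Γ⃗^log_arc`: `k~ → k~ ↠ k^× ↪ k`), (vii) p. 128 ("respectively, `ι_{v,ε}`" for EVERY edge `ε` of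
`Γ⃗^log_v`).

Bookkeeping over abc-iut-L4-t3's real (finite) definitions `NonarchVertex`/`NonarchEdge`, `ArchVertex`/`ArchEdge`,
`LogVertex`, `LogEdge` (= `Γ⃗^⋉_v`, the `ι⊞`-carrying edges) and `LogEdgeTS` (= all of `Γ⃗^log_v`, the index set of the
`TS`-valued `ι_{v,ε}` of Def 5.4 (vii)), for the move system of the observable `S_log` of Cor 5.5 (iii)
(`LogFrobeniusObservablesTSMoves.lean`, `LogFrobeniusObservablesTSOfIotaSquare.lean`; the `⊞`-side is abc-iut-f-101's
`LogFrobeniusObservablesMoves.lean`, whose `LogVertex.rank` / `logEdge_fork` this file parallels).  Everything is stated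
UNIFORMLY in the Boolean "archimedean" `b` (so that it applies to `b := isArc v` without transport) and proved by
`cases b` and exhaustion of the finite graphs:

* `LogVertex.rankTS` — a rank decreasing along EVERY edge out of a pre-log vertex (the space-link vertex `k̄` now
  RECEIVES the `TS`-only edge from `k̄^×`, so — unlike on the `⊞`-side — its rank lies below that of `k̄^×`:
  nonarchimedean `𝒪^× ↦ 3`, `k̄^× ↦ 2`, `k~ ↦ 2`, `(k̄^×)^pf ↦ 0`, `k̄ ↦ 0`, post-log `↦ 0`; archimedean `k~ ↦ 2`, `k^× ↦ 1`,
  `k ↦ 0`), `rankTS_lt_of_logEdgeTS`, and `< 3` (the weight of `log`) at the target of the post-log arrow;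
* edges are determined by their end-vertices, nothing leaves the space-link vertex, exactly one edge leaves the post-log
  vertex, edge targets are pre-log;
* ★ `logEdgeTS_fork` — the FORK CLASSIFICATION: two distinct edges out of one pre-log vertex exist only at a
  nonarchimedean place and form either the CLOSING fork `𝒪^×_k̄ → {k̄^×, k~}` (both branches continue into the common
  pre-log sink `(k̄^×)^pf` — the commutative square of Def 5.4 (iii) — the branch `k̄^×` having exactly one further exit,
  into `k̄`) or the `TS`-only DIVERGING fork `k̄^× → {(k̄^×)^pf, k̄}` (a pre-log sink and the space-link vertex: the two
  branches never meet again);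
* `logEdgeTS_diamond_toTS` — a NON-DEGENERATE diamond `νa → νb → νd`, `νa → νc → νd` (`νb ≠ νc`) of `Γ⃗^log_v` consists of
  edges of `Γ⃗^⋉_v` between pre-log end-vertices: the only square along which the `TS`-valued `ι_{v,ε}` can be asked to
  commute is print's Def 5.4 (iii) square; the `TS`-only `ι_{v,k̄^×↪k̄}` enters no square.

Nothing is asserted about print (finite combinatorics of typed graphs).  Refereed pre-IUT material; nothing here bears
on [IUTchIII] Cor. 3.12; no side taken.
-/

set_option autoImplicit false

namespace Literature.AnabelianGeometry.AbsoluteAnabelian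

/-! ## Combinatorics of the full graph `Γ⃗^log_v`: rank, sinks, forks, diamonds — uniformly in the Boolean -/

namespace LogVertex

/-- A rank on the vertices of `Γ⃗^log_v` that strictly DECREASES along EVERY edge out of a pre-log vertex (including the
`TS`-only arrow `k̄^× ↪ k̄` into the space-link vertex) and is `< 3` at the target of the post-log arrow: the termination
measure of the move system of `S_log`. [cite: MochizukiAbsTopIII2015, Def 5.4 (iii) p. 126] -/
def rankTS : (b : Bool) → LogVertex b → ℕ
  | true, ArchVertex.pre => 2
  | true, ArchVertex.mult => 1
  | true, ArchVertex.spaceLink => 0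
  | true, ArchVertex.postLog => 0
  | false, NonarchVertex.units => 3
  | false, NonarchVertex.mult => 2
  | false, NonarchVertex.shellCod => 2
  | false, NonarchVertex.perf => 0
  | false, NonarchVertex.spaceLink => 0
  | false, NonarchVertex.postLog => 0

/-- The rank decreases along every edge of `Γ⃗^log_v` out of a pre-log vertex (`𝒪^× ↪ k̄^×`, `𝒪^× → k~`,
`k̄^× → (k̄^×)^pf`, `k̄^× ↪ k̄`, `k~ ↪ (k̄^×)^pf`; `k~ ↠ k^× ↪ k`). [cite: MochizukiAbsTopIII2015, Def 5.4 (iii) p. 126] -/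
theorem rankTS_lt_of_logEdgeTS (b : Bool) {ν₁ ν₂ : LogVertex b} (ε : LogEdgeTS b ν₁ ν₂) (h₁ : ν₁.isPostLog = false) :
    rankTS b ν₂ < rankTS b ν₁ := by
  cases b
  · revert h₁ ε
    change NonarchEdge ν₁ ν₂ → _
    intro e
    cases e <;> simp [rankTS, LogVertex.isPostLog, NonarchVertex.IsPostLog]
  · revert h₁ ε
    change ArchEdge ν₁ ν₂ → _
    intro e
    cases e <;> simp [rankTS, LogVertex.isPostLog, ArchVertex.IsPostLog]

/-- The space-link vertex has rank `0`. [cite: MochizukiAbsTopIII2015, Def 5.4 (iii) p. 126] -/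
theorem rankTS_spaceLink (b : Bool) : rankTS b (LogVertex.spaceLink b) = 0 := by
  cases b <;> rfl

/-- The target of the post-log arrow has rank `< 3` (the weight of `log`): the `post`-move lowers the weight.
[cite: MochizukiAbsTopIII2015, Def 5.4 (iii) p. 126] -/
theorem rankTS_lt_of_logEdgeTS_post (b : Bool) {ν₁ ν₂ : LogVertex b} (ε : LogEdgeTS b ν₁ ν₂)
    (h₁ : ν₁.isPostLog = true) : rankTS b ν₂ < 3 := by
  cases b
  · revert h₁ ε
    change NonarchEdge ν₁ ν₂ → _
    intro e
    cases e <;> simp [rankTS, LogVertex.isPostLog, NonarchVertex.IsPostLog]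
  · revert h₁ ε
    change ArchEdge ν₁ ν₂ → _
    intro e
    cases e <;> simp [rankTS, LogVertex.isPostLog, ArchVertex.IsPostLog]

/-- There is at most one edge of `Γ⃗^log_v` between two vertices. [cite: MochizukiAbsTopIII2015, Def 5.4 (iii) p. 126] -/
theorem logEdgeTS_subsingleton (b : Bool) {ν₁ ν₂ : LogVertex b} (ε ε' : LogEdgeTS b ν₁ ν₂) : ε = ε' := by
  cases b
  · revert ε ε'
    change ∀ e e' : NonarchEdge ν₁ ν₂, e = e'
    intro e e'
    cases e <;> cases e' <;> rfl
  · revert ε ε'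
    change ∀ e e' : ArchEdge ν₁ ν₂, e = e'
    intro e e'
    cases e <;> cases e' <;> rfl

/-- The space-link vertex (`k̄`, resp. `k`) has no outgoing edge in `Γ⃗^log_v`. [cite: MochizukiAbsTopIII2015, Def 5.4 (iii) p. 126] -/
theorem isEmpty_logEdgeTS_spaceLink (b : Bool) (ν : LogVertex b) : IsEmpty (LogEdgeTS b (LogVertex.spaceLink b) ν) := by
  cases b
  · refine ⟨fun ε => ?_⟩
    revert ε
    change NonarchEdge NonarchVertex.spaceLink ν → False
    intro e
    cases e
  · refine ⟨fun ε => ?_⟩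
    revert ε
    change ArchEdge ArchVertex.spaceLink ν → False
    intro e
    cases e

/-- The source of an edge of `Γ⃗^log_v` is not the space-link vertex. [cite: MochizukiAbsTopIII2015, Def 5.4 (iii) p. 126] -/
theorem ne_spaceLink_of_logEdgeTS (b : Bool) {ν₁ ν₂ : LogVertex b} (ε : LogEdgeTS b ν₁ ν₂) :
    ν₁ ≠ LogVertex.spaceLink b := by
  rintro rfl
  exact (isEmpty_logEdgeTS_spaceLink b ν₂).false ε

/-- The target of an edge of `Γ⃗^log_v` is a pre-log vertex (nothing enters the post-log vertex).
[cite: MochizukiAbsTopIII2015, Def 5.4 (iii) p. 126] -/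
theorem isPostLog_eq_false_of_logEdgeTS (b : Bool) {ν₁ ν₂ : LogVertex b} (ε : LogEdgeTS b ν₁ ν₂) :
    ν₂.isPostLog = false := by
  cases b
  · revert ε
    change NonarchEdge ν₁ ν₂ → _
    intro e
    cases e <;> rfl
  · revert ε
    change ArchEdge ν₁ ν₂ → _
    intro e
    cases e <;> rfl

/-- Out of the post-log vertex there is exactly one edge: its target is determined.
[cite: MochizukiAbsTopIII2015, Def 5.4 (iii) p. 126] -/
theorem logEdgeTS_post_target_eq (b : Bool) {ν₁ ν₂ ν₂' : LogVertex b} (h₁ : ν₁.isPostLog = true)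
    (ε : LogEdgeTS b ν₁ ν₂) (ε' : LogEdgeTS b ν₁ ν₂') : ν₂ = ν₂' := by
  cases b
  · revert h₁ ε ε'
    change _ → NonarchEdge ν₁ ν₂ → NonarchEdge ν₁ ν₂' → _
    intro h₁ e e'
    cases e <;> cases e' <;> first | rfl | exact absurd h₁ (by decide)
  · revert h₁ ε ε'
    change _ → ArchEdge ν₁ ν₂ → ArchEdge ν₁ ν₂' → _
    intro h₁ e e'
    cases e <;> cases e' <;> rfl

/-- **The forks of the full graph `Γ⃗^log_v`.**  Two DISTINCT edges out of one pre-log vertex `ν₁` exist only at a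
nonarchimedean place, in one of two configurations (up to the order of the two edges): CLOSING — out of `𝒪^×_k̄`
towards `a = k̄^×` and `b = k~`, where both continue into a common pre-log SINK `ν₃ = (k̄^×)^pf` (the commutative square of
Def 5.4 (iii)), `b` has no other exit and `a` has exactly one other exit, into the space-link vertex; DIVERGING — out of
`k̄^×` towards the space-link vertex `a = k̄` and the pre-log sink `b = (k̄^×)^pf` (the `TS`-only configuration).  Stated
uniformly in the Boolean `b`. [cite: MochizukiAbsTopIII2015, Def 5.4 (iii) p. 126] -/
theorem logEdgeTS_fork (b : Bool) {ν₁ ν₂ ν₂' : LogVertex b} (h₁ : ν₁.isPostLog = false) (ε : LogEdgeTS b ν₁ ν₂)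
    (ε' : LogEdgeTS b ν₁ ν₂') (hne : ν₂ ≠ ν₂') :
    (∃ (a c : LogVertex b) (_ : (a = ν₂ ∧ c = ν₂') ∨ (a = ν₂' ∧ c = ν₂)) (ν₃ : LogVertex b)
        (_ : LogEdgeTS b a ν₃) (_ : LogEdgeTS b c ν₃),
        ν₃.isPostLog = false ∧ ν₃ ≠ LogVertex.spaceLink b ∧ (∀ ν₄, IsEmpty (LogEdgeTS b ν₃ ν₄)) ∧
          (∀ ν₄, LogEdgeTS b a ν₄ → ν₄ = ν₃ ∨ ν₄ = LogVertex.spaceLink b) ∧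
          (∀ ν₄, LogEdgeTS b c ν₄ → ν₄ = ν₃)) ∨
      ∃ (a c : LogVertex b) (_ : (a = ν₂ ∧ c = ν₂') ∨ (a = ν₂' ∧ c = ν₂)),
        a = LogVertex.spaceLink b ∧ c.isPostLog = false ∧ c ≠ LogVertex.spaceLink b ∧
          ∀ ν₄, IsEmpty (LogEdgeTS b c ν₄) := by
  cases b
  · revert h₁ ε ε' hne
    change _ → NonarchEdge ν₁ ν₂ → NonarchEdge ν₁ ν₂' → _
    intro h₁ e e' hne
    have perfNe : (NonarchVertex.perf : LogVertex false) ≠ LogVertex.spaceLink false := by rintro ⟨⟩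
    have sinkPerf : ∀ ν₄ : LogVertex false, IsEmpty (LogEdgeTS false NonarchVertex.perf ν₄) := fun ν₄ =>
      ⟨fun γ => by revert γ; change NonarchEdge NonarchVertex.perf ν₄ → False; intro g; cases g⟩
    have outMult : ∀ ν₄ : LogVertex false, LogEdgeTS false NonarchVertex.mult ν₄ →
        ν₄ = NonarchVertex.perf ∨ ν₄ = LogVertex.spaceLink false := fun ν₄ γ => by
      revert γ
      change NonarchEdge NonarchVertex.mult ν₄ → _
      intro g
      cases g
      · exact Or.inr rfl
      · exact Or.inl rfl
    have outShellCod : ∀ ν₄ : LogVertex false, LogEdgeTS false NonarchVertex.shellCod ν₄ → ν₄ = NonarchVertex.perf :=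
      fun ν₄ γ => by
        revert γ
        change NonarchEdge NonarchVertex.shellCod ν₄ → _
        intro g
        cases g
        rfl
    cases e <;> cases e' <;>
      first
        | exact absurd rfl hne
        | exact absurd h₁ (by decide)
        | exact Or.inl ⟨NonarchVertex.mult, NonarchVertex.shellCod, Or.inl ⟨rfl, rfl⟩, NonarchVertex.perf,
            NonarchEdge.multToPerf, NonarchEdge.shellCodToPerf, rfl, perfNe, sinkPerf, outMult, outShellCod⟩
        | exact Or.inl ⟨NonarchVertex.mult, NonarchVertex.shellCod, Or.inr ⟨rfl, rfl⟩, NonarchVertex.perf,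
            NonarchEdge.multToPerf, NonarchEdge.shellCodToPerf, rfl, perfNe, sinkPerf, outMult, outShellCod⟩
        | exact Or.inr ⟨NonarchVertex.spaceLink, NonarchVertex.perf, Or.inl ⟨rfl, rfl⟩, rfl, rfl, perfNe, sinkPerf⟩
        | exact Or.inr ⟨NonarchVertex.spaceLink, NonarchVertex.perf, Or.inr ⟨rfl, rfl⟩, rfl, rfl, perfNe, sinkPerf⟩
  · revert h₁ ε ε' hne
    change _ → ArchEdge ν₁ ν₂ → ArchEdge ν₁ ν₂' → _
    intro h₁ e e' hne
    cases e <;> cases e' <;> exact absurd rfl hne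

/-- **The diamonds of the full graph `Γ⃗^log_v` lie in `Γ⃗^⋉_v`.**  Two 2-chains of edges `νa → νb → νd`, `νa → νc → νd` with
`νb ≠ νc` exist only at a nonarchimedean place (`𝒪^×_k̄ ↪ k̄^× → (k̄^×)^pf`, `𝒪^×_k̄ → k~ ↪ (k̄^×)^pf` — the commutative square
of Def 5.4 (iii)); all four edges are then edges of `Γ⃗^⋉_v` (along which Def 5.4 (vii) provides `ι⊞_{v,ε}`), and `νa`, `νd`
are pre-log. [cite: MochizukiAbsTopIII2015, Def 5.4 (iii) p. 126] -/
theorem logEdgeTS_diamond_toTS (b : Bool) {νa νb νc νd : LogVertex b} (ε₁ : LogEdgeTS b νa νb)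
    (ε₂ : LogEdgeTS b νb νd) (ε₃ : LogEdgeTS b νa νc) (ε₄ : LogEdgeTS b νc νd) (hne : νb ≠ νc) :
    ∃ (_ : νa.isPostLog = false) (_ : νd.isPostLog = false) (e₁ : LogEdge b νa νb) (e₂ : LogEdge b νb νd)
      (e₃ : LogEdge b νa νc) (e₄ : LogEdge b νc νd), ε₁ = e₁.toTS ∧ ε₂ = e₂.toTS ∧ ε₃ = e₃.toTS ∧ ε₄ = e₄.toTS := by
  cases b
  · dsimp only [LogEdgeTS] at ε₁ ε₂ ε₃ ε₄
    cases ε₁ <;> cases ε₃ <;> cases ε₂ <;> cases ε₄ <;>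
      first
        | exact absurd rfl hne
        | exact ⟨rfl, rfl, ⟨NonarchEdge.unitsToMult, trivial⟩, ⟨NonarchEdge.multToPerf, trivial⟩,
            ⟨NonarchEdge.shell, trivial⟩, ⟨NonarchEdge.shellCodToPerf, trivial⟩, rfl, rfl, rfl, rfl⟩
        | exact ⟨rfl, rfl, ⟨NonarchEdge.shell, trivial⟩, ⟨NonarchEdge.shellCodToPerf, trivial⟩,
            ⟨NonarchEdge.unitsToMult, trivial⟩, ⟨NonarchEdge.multToPerf, trivial⟩, rfl, rfl, rfl, rfl⟩
  · dsimp only [LogEdgeTS] at ε₁ ε₂ ε₃ ε₄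
    cases ε₁ <;> cases ε₃ <;> exact absurd rfl hne

end LogVertex

end Literature.AnabelianGeometry.AbsoluteAnabelian
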